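import Summits.Ventures.QEC.Census.BB.BB72.InfoSetZ1
import HarnessLib

/-!
# `BB72` — KERNEL-tier lower bound, side Z, information-set certificate, file 2/3 (qec-search-7)

Label-free information-set certificate (Census/CertInfoSet.lean + CertInfoSetSound.lean, PARTITION v2.2 item
07.IS) for side Z of the certificate `7e943c5a566adc43`: the syndrome matrix `cert.HX` (36 rows, rank 30) in reduced
row-echelon form — 30 pivot columns `piv`, reduced rows `red` (each the XOR of the listed original rows, `comb`) — and the
standard kernel basis of its 42 free columns; every XOR of between 1 and 5 basis vectors has ≥ 6 set bits
(974981 XORs in 42 first-generator chunks, each one `decide +kernel`; test word `hasBits6`). Consequence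
(`DistCert.dZ_code_of_infoSet`): every nonzero `v : Fin 72 → ZMod 2` with `cert.HX · v = 0` has weight ≥ 6 — the lower
half of `d_Z = 6`. Tier KERNEL (CERTIFIED): axioms ⊆ {propext, Classical.choice, Quot.sound}. Data computed by
HOME/census/search-7/emit_infoset.py from the certificate's `HX`; the emitter's row reduction is NOT trusted
(`isZ_struct` re-checks pivots and decompositions in the kernel).
This file: chunks 4 … 10 (378567 XORs).
-/

namespace Summit.Ventures.QEC.Census.BB72

/-- Chunk 4: every XOR of ≤ 5 kernel-basis vectors whose first vector is basis vector 4 has ≥ 6 set bits (74519 XORs). -/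
theorem isZ_c4 : ichunk hasBits6 (kerBasis 72 isZ.piv isZ.red) 3 4 = true := by decide +kernel

/-- Chunk 5: every XOR of ≤ 5 kernel-basis vectors whose first vector is basis vector 5 has ≥ 6 set bits (66712 XORs). -/
theorem isZ_c5 : ichunk hasBits6 (kerBasis 72 isZ.piv isZ.red) 3 5 = true := by decide +kernel

/-- Chunk 6: every XOR of ≤ 5 kernel-basis vectors whose first vector is basis vector 6 has ≥ 6 set bits (59536 XORs). -/
theorem isZ_c6 : ichunk hasBits6 (kerBasis 72 isZ.piv isZ.red) 3 6 = true := by decide +kernel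

/-- Chunk 7: every XOR of ≤ 5 kernel-basis vectors whose first vector is basis vector 7 has ≥ 6 set bits (52956 XORs). -/
theorem isZ_c7 : ichunk hasBits6 (kerBasis 72 isZ.piv isZ.red) 3 7 = true := by decide +kernel

/-- Chunk 8: every XOR of ≤ 5 kernel-basis vectors whose first vector is basis vector 8 has ≥ 6 set bits (46938 XORs). -/
theorem isZ_c8 : ichunk hasBits6 (kerBasis 72 isZ.piv isZ.red) 3 8 = true := by decide +kernel

/-- Chunk 9: every XOR of ≤ 5 kernel-basis vectors whose first vector is basis vector 9 has ≥ 6 set bits (41449 XORs). -/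
theorem isZ_c9 : ichunk hasBits6 (kerBasis 72 isZ.piv isZ.red) 3 9 = true := by decide +kernel

/-- Chunk 10: every XOR of ≤ 5 kernel-basis vectors whose first vector is basis vector 10 has ≥ 6 set bits (36457 XORs). -/
theorem isZ_c10 : ichunk hasBits6 (kerBasis 72 isZ.piv isZ.red) 3 10 = true := by decide +kernel

end Summit.Ventures.QEC.Census.BB72
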